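import Literature.MathematicalPhysics.QuantumFieldTheory.Borinsky2020.SectorTableRecursion
import Literature.MathematicalPhysics.QuantumFieldTheory.Borinsky2020.GeneralizedPermutahedronSampling
import Literature.MathematicalPhysics.QuantumFieldTheory.Borinsky2020.KirchhoffPermutahedron
import Literature.Combinatorics.Matroid.HeppBoundIdentities
import Literature.Combinatorics.Matroid.HeppBoundProofs
import Literature.MathematicalPhysics.QuantumFieldTheory.HeppBound
import HarnessLib

/-!
# The tropical normalisation of a logarithmically divergent Feynman integrand IS the Hepp bound: `I^tr_G = J_{r_G}(G) = Hepp_D(G, ν⃗)` for `ω(G) = 0` (Borinsky 2020 §7.2 with Definition 28 / Proposition 29; Borinsky–Munch–Tellander 2023 eq. (mutr); Panzer 2022 Def. 2.4) — PROVED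

independent recomputation; certified where stated, statistical where stated; no new-physics claim.

CITATION HEADER (venture `QEDPrecision`, cell `pub-qed`, track TROPICAL, LIT seat `pub-qed-trop-lit` gen 29; VALUE-FREE: an identity
between two rational functions of the indices attached to an arbitrary connected edge list, and its integral form; no number of any
word is computed). Companion of `KirchhoffPermutahedron.lean` (same seat, same day), which types the graph data
`𝒜 = Σ_e ν_e NP_{x_e} = 𝒢_{z_ν}`, `ℬ = (D/2) NP_{Ψ_G} = 𝒢_{(D/2)ℓ}`, `r_G = z_ν − (D/2)ℓ = ω` of Borinsky's §7.2 for the `Φ`-free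
integrand; of `GeneralizedPermutahedronSampling.lean` (Proposition 29 `I^tr = J_r([n])`, Algorithm 4 = Proposition 31); and of the
Hepp-bound files `Combinatorics/Matroid/HeppBound*.lean`, `QuantumFieldTheory/HeppBound.lean` (Panzer's `Hepp_D(G, a⃗)`, the
`KontsevichZagierPeriods` route's objects). It ties the two vocabularies: the TROPICAL track's sector table `J_r` (the `2ⁿ`-table
a generalized-permutahedron sampler precomputes) and Panzer's Hepp bound are ONE function of the graph.

SOURCES, VERBATIM. [Borinsky2020] M. Borinsky, AIHPD 10 (2023) 635–685 = arXiv:2008.12310v2 (HOME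
`data/lit/sources/.cache/2008.12310/tropical.tex`, e-print flat numbering; journal: Definition 28 / Proposition 29 = Def. 6.7 /
Prop. 6.8), §6.2 **Definition 28** (l.1107–1111): "For a boolean function r : 2^[n] → ℝ with r(∅) = 1 and r(A) > 0 for all
non-empty A ⊊ [n], we define the boolean function J_r : 2^[n] → ℝ_{>0} recursively as J_r(A) = Σ_{e∈A} J_r(A∖e)/r(A∖e) for all
non-empty A ⊂ [n] where J_r(∅) = 1."; **Proposition 29** (l.1112–1116): "If r(A) = z_𝒜(A) − z_ℬ(A) for all non-empty A ⊊ [n] and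
r(∅) = 1, then I^tr = J_r([n])." (proof: "J_r(A) = Σ_{σ : [m] → A} 1/Π_{k=1}^{m−1} r(A^σ_k), where the sum is over all bijections
σ : [m] → A" — Panzer's Def. 2.4 sum read in removal order); §7.2 (l.1240–1253): "r_G(γ) = z_𝒜(γ) −
z_ℬ(γ) = … = Σ_{e∈γ} ν_e − (D/2) ℓ(γ) − ω(G) δ_{m.m.}(γ) for all non-empty γ ⊂ G … Note that up to the δ_{m.m.}-term the function
r_G(γ) is equal to the superficial degree of divergence ω(γ) of a subgraph.", "the tropical differential form associated to I_G is
μ^tr_G = (1/I^tr_G) Π_e x_e^{ν_e}/Ψ_G^tr(x)^{D/2} (Ψ_G^tr(x)/Φ_G^tr(x))^{ω(G)} Ω, with an appropriate normalization factor I^tr_G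
such that 1 = ∫ μ^tr_G. For ω(G)=0 this normalization factor is a certain invariant of the graph G which has been studied by Panzer.
This invariant is the Hepp-bound. The Hepp-bound is independent of the physical parameters encoded in the masses and external
momenta.", "J_G(γ) = Σ_{e∈γ} J_G(γ∖e)/r_G(γ∖e) … The actual normalization factor is recovered for γ = G, i.e. I_G^tr = J_G(G) by
Proposition 29." [BorinskyMunchTellander2023] M. Borinsky, H. J. Munch, F. Tellander, Comput. Phys. Commun. 292 (2023) 108874 =
arXiv:2302.08955v2 (HOME `data/lit/sources/.cache/2302.08955/main.tex`), §3.2 eq. (mutr) (l.644–654): "μ^tr = (1/I^tr) Π_e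
x_e^{ν_e}/(𝒰^tr(x)^{D_0/2} 𝒱^tr(x)^{ω_0}) Ω, where I^tr is a normalization factor, which is chosen such that ∫ μ^tr = 1. … If ω_0 = 0,
this normalization factor is equal to the associated Hepp bound of the graph G [Panzer]."; §3.4 (l.971–980): "J(γ) = Σ_{e∈γ}
J(γ∖e)/ω(γ∖e) … J(E) = I^tr". [Panzer2022] E. Panzer, "Hepp's bound for Feynman graphs and matroids", AIHPD 10 (2023) 31–119 =
arXiv:1908.09820 (held `paper:arxiv-1908.09820`), Def. 2.4 (`Hepp_D(G, a⃗) = Σ_σ Π_{k=1}^{N−1} ω(G^σ_k)⁻¹`, typed as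
`heppSumOfCorank` / `graphHeppBoundDim` in the tree's Hepp-bound files, whose headers quote it) and the recursion over the deleted
edge `Hepp(M) = Σ_e Hepp(M∖e)/ω(M∖e)` (§3.1 after Ex. 3.5; typed as `HeppBoundIdentities.heppSumOfCorank_eq_sum_erase`).

TYPING / PROOF (no new definition — D-0026). `sectorTable r A` = J_r(A) of `SectorTableRecursion.lean`; Panzer's side =
`heppSumOfCorank ℓ A D a` / `graphHeppBoundDim E D ν` with `graphSdc E D ν γ = Σ_{e∈γ} ν_e − (D/2) ℓ(γ)` (`HeppBound.lean`). The
boolean function is `r(B) = if B = ∅ then 1 else ω(B)` — EXACTLY the `r` in the conclusion of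
`GeneralizedPermutahedronSampling.integral_tropical_eq_sectorTable_of_gp` ("with r(∅) = 1"). (1) `sectorTable_sdc_eq_heppSumOfCorank`:
both functions of `A` satisfy the same recursion over the removed edge (`sectorTable_eq` = Definition 28; `heppSumOfCorank_eq_sum_erase`
for `|A| ≥ 2`) with the same values `1` at `|A| ≤ 1` (`sectorTable_empty`, `orderings_empty`, `heppSumOfCorank_singleton`) — strong
induction on `|A|`; for `|A| ≥ 2` the removed sets `A∖e` are non-empty, so the `r(∅) = 1` clause never fires inside the recursion.
(2) `sectorTable_graphSdc_eq_graphHeppBoundDim`: the graph instance `ℓ = loopNumber E` (definitional). (3)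
**`integral_tropical_kirchhoff_eq_graphHeppBoundDim`**: for a connected edge list with `n+1` edges, `ν ≥ 0`, `D ≥ 0`, `ω(γ) > 0` on
the non-empty proper edge sets and `ω(G) = 0`, the chart integral `∫_{ℝⁿ} Π_e x_e^{ν_e}/Ψ_E^tr(x)^{D/2} dy` (`x = e^{(y,0)}`, the
typing of `I^tr` in `ConvergenceTheorem.lean` / `GeneralizedPermutahedronSampling.lean`) equals `graphHeppBoundDim E D ν` —
`integral_tropical_eq_sectorTable_of_gp` instantiated with `a_e = X_e` (weights `ν_e`), `b = Ψ_E` (weight `D/2`), `z_𝒜 = z_ν`,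
`z_ℬ = (D/2)ℓ` (hypotheses `hA`, `hB` = `KirchhoffPermutahedron.sum_smul_newtonPolytope_X_eq_gpPolytope` /
`smul_newtonPolytope_kirchhoffPolynomial_eq_gpPolytope`; `r > 0` and `z_𝒜([n]) = z_ℬ([n])` = the two `ω` hypotheses via
`graphSdc_eq_weights_sub_smul_loopNumber`), `trop (X e) x = x_e` (`trop_X`), then (2).

PROVED (0 named facts, 0 definitions): `sectorTable_sdc_eq_heppSumOfCorank`, `sectorTable_graphSdc_eq_graphHeppBoundDim`, `trop_X`,
**`integral_tropical_kirchhoff_eq_graphHeppBoundDim`**. NOT typed / does NOT say: `ω(G) ≠ 0` (the `(Ψ/Φ)^{ω(G)}` factor and the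
`δ_{m.m.}` term of `r_G` need `Φ_G` — not in this lane); the unit-index case `H(G)` of Panzer's eq. (1.5) is the instance `ν = 1`,
`D = 4`, `N = 2ℓ(G)` (`graphUnitHeppBound`, `HeppBound.graphHeppBound_one`) and is not restated; the projective / chart-independence
reading of `I^tr` (one chart, as in all companions); nothing about any sampler implementation, word, or variance.
(Filed by the pub-qed TROPICAL literature seat `pub-qed-trop-lit` gen 29; `tropical/lit/SOURCES.md` A32.)
-/

noncomputable section

namespace Literature.MathematicalPhysics.QuantumFieldTheory.Borinsky2020

open Finset
open Literature.Combinatorics.Matroid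

variable {α : Type*} [DecidableEq α]

/-- **Definition 28's table for `r = ω` IS Panzer's Hepp sum**: for any corank function `ℓ`, dimension `D` and indices `a⃗`,
the sector table `J_r(A)` of the boolean function `r(B) = ω(B) = Σ_{e∈B} a_e − (D/2) ℓ(B)` (with the printed convention
`r(∅) = 1`) equals `Hepp_D(A, a⃗) = Σ_σ Π_{k=1}^{|A|−1} ω(A^σ_k)⁻¹` — both satisfy the recursion over the last / removed edge,
"J_r(A) = Σ_{e∈A} J_r(A∖e)/r(A∖e)" (Borinsky, Definition 28) = "Hepp(M) = Σ_e Hepp(M∖e)/ω(M∖e)" (Panzer, the recursion displayed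
after Ex. 3.5, typed as `HeppBoundIdentities.heppSumOfCorank_eq_sum_erase`), with `J_r(∅) = 1 = Hepp` of a single edge.
[cite: Borinsky2020, §6.2 Definition 28 and Proposition 29 (tropical.tex l.1107–1122); Panzer2022, Def. 2.4 and §3.1 (recursion after Ex. 3.5)] -/
theorem sectorTable_sdc_eq_heppSumOfCorank (ℓ : Finset α → ℕ) (D : ℝ) (a : α → ℝ) (A : Finset α) :
    sectorTable (fun B : Finset α => if B = ∅ then (1 : ℝ) else sdcOfCorank ℓ D a B) A =
      heppSumOfCorank ℓ A D a := by
  suffices h : ∀ (n : ℕ) (A : Finset α), A.card = n →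
      sectorTable (fun B : Finset α => if B = ∅ then (1 : ℝ) else sdcOfCorank ℓ D a B) A =
        heppSumOfCorank ℓ A D a from h _ A rfl
  intro n
  induction n using Nat.strong_induction_on with
  | _ n ih =>
    intro A hA
    rcases Nat.lt_or_ge n 2 with hn | hn
    · -- `|A| ≤ 1`: both sides are `1`
      interval_cases n
      · rw [Finset.card_eq_zero.1 hA, sectorTable_empty, heppSumOfCorank_eq, orderings_empty]
        simp
      · obtain ⟨e, rfl⟩ := Finset.card_eq_one.1 hA
        rw [heppSumOfCorank_singleton, sectorTable_eq _ (Finset.singleton_nonempty e), Finset.sum_singleton,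
          Finset.erase_singleton, sectorTable_empty]
        simp
    · -- `|A| ≥ 2`: the two recursions over the removed edge agree term by term
      have hAne : A.Nonempty := Finset.card_pos.1 (by omega)
      rw [sectorTable_eq _ hAne, heppSumOfCorank_eq_sum_erase ℓ A (hA ▸ hn) D a]
      refine Finset.sum_congr rfl fun e he => ?_
      have hcard : (A.erase e).card = n - 1 := by rw [Finset.card_erase_of_mem he, hA]
      have hne : A.erase e ≠ ∅ := by
        rw [← Finset.nonempty_iff_ne_empty, ← Finset.card_pos, hcard]
        omega
      rw [ih (n - 1) (by omega) (A.erase e) hcard, if_neg hne, div_eq_mul_inv]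

end Literature.MathematicalPhysics.QuantumFieldTheory.Borinsky2020

namespace Literature.MathematicalPhysics.QuantumFieldTheory

open Finset
open Literature.MathematicalPhysics.QuantumFieldTheory.Borinsky2020

variable {N V : ℕ} (E : Fin N → Fin (V + 1) × Fin (V + 1))

/-- **"For ω(G) = 0 this normalization factor is … the Hepp-bound"** (Borinsky 2020, §7.2; BMT23: "If ω_0 = 0, this normalization
factor is equal to the associated Hepp bound of the graph G"): the sector table `J_{r_G}([N])` of Definition 28 / Proposition 29
(`I^tr_G = J_{r_G}(G)`) for the boolean function `r_G(γ) = Σ_{e∈γ} ν_e − (D/2) ℓ(γ)` of §7.2 (the `ω(G) = 0` case, no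
`δ_{m.m.}` term; `r_G(∅) = 1`) IS Panzer's Hepp bound `Hepp_D(G, ν⃗)` of the edge list (`HeppBound.graphHeppBoundDim`,
Def. 2.4). The analytic half `I^tr = J_r([n])` is `GeneralizedPermutahedronSampling.integral_tropical_eq_sectorTable_of_gp`.
[cite: Borinsky2020, §7.2 (tropical.tex l.1240–1253), Proposition 29; BorinskyMunchTellander2023, §3.2 eq. (mutr) (main.tex l.644–654); Panzer2022, Def. 2.4] -/
theorem sectorTable_graphSdc_eq_graphHeppBoundDim (D : ℝ) (ν : Fin N → ℝ) :
    sectorTable (fun B : Finset (Fin N) => if B = ∅ then (1 : ℝ) else graphSdc E D ν B) univ =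
      graphHeppBoundDim E D ν :=
  sectorTable_sdc_eq_heppSumOfCorank (loopNumber E) D ν univ

/-! ## The tropicalised Feynman integrand `Π_e x_e^{ν_e}/Ψ_G^tr(x)^{D/2}` (ω(G) = 0): `I^tr_G = Hepp_D(G, ν⃗)` -/

section Integral

open MvPolynomial Real MeasureTheory
open scoped Pointwise

/-- The exponent vectors of `p` read in `ℝⁿ` — the same local notation as in `ConvergenceTheorem.lean` /
`GeneralizedPermutahedronSampling.lean` / `KirchhoffPermutahedron.lean` (no new definition is introduced). -/
local notation3 (prettyPrint := false) "pts⟦" p "⟧" =>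
  ((fun d : (_ →₀ ℕ) => fun k => ((d k : ℕ) : ℝ)) '' {d | d ∈ MvPolynomial.support p})

/-- The Newton polytope `NP_p = conv(supp p)` — the same local notation as in the companions (no new definition). -/
local notation3 (prettyPrint := false) "NP⟦" p "⟧" => convexHull ℝ pts⟦p⟧

/-- `p^tr` of the monomial `p_e = x_e` is `x_e` (Definition 6 for a one-term polynomial). [cite: Borinsky2020, Definition 6 (tropical.tex l.399–403); §7.2 (l.1235)] -/
theorem trop_X {m : ℕ} (e : Fin m) (x : Fin m → ℝ) : trop (X e : MvPolynomial (Fin m) ℝ) x = x e := by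
  rw [trop_of_ne_zero (X_ne_zero e)]
  simp only [MvPolynomial.support_X, Finset.sup'_singleton, monom]
  rw [Finsupp.support_single _ one_ne_zero, Finset.prod_singleton, Finsupp.single_eq_same, pow_one]

/-- **"For ω(G) = 0 this normalization factor is … the Hepp-bound" — the full statement for the tree's chart integral**: for a
connected edge list `G` with `N = n+1` edges, real indices `ν_e ≥ 0` and a dimension `D ≥ 0` such that `ω(G) = Σ_e ν_e −
(D/2) ℓ(G) = 0` and `ω(γ) > 0` for every non-empty proper edge set `γ` (Theorem 27's `r_G > 0` = Panzer's convergence cone),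
the tropical normalisation `I^tr_G = ∫ Π_e x_e^{ν_e}/Ψ_G^tr(x)^{D/2} Ω` of eq. (mu_probability) / §7.2 — typed, as in
`GeneralizedPermutahedronSampling.lean`, in the chart `x_n = 1` in logarithmic coordinates, `x = e^{(y,0)}` — EQUALS Panzer's
Hepp bound `Hepp_D(G, ν⃗)` (`HeppBound.graphHeppBoundDim`). Assembled from `integral_tropical_eq_sectorTable_of_gp`
(Proposition 29: `I^tr = J_r([n])`) with the graph data of `KirchhoffPermutahedron.lean` (`𝒜 = Σ_e ν_e NP_{x_e} = 𝒢_{z_ν}`,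
`ℬ = (D/2) NP_{Ψ_G} = 𝒢_{(D/2)ℓ}`, `r_G = z_ν − (D/2)ℓ = ω`) and `sectorTable_graphSdc_eq_graphHeppBoundDim`.
[cite: Borinsky2020, §7.2 (tropical.tex l.1233–1253), Proposition 29 (l.1112–1122), eq. (mu_probability) (l.887–893); BorinskyMunchTellander2023, §3.2 eq. (mutr) (main.tex l.644–654); Panzer2022, Def. 2.4 and Prop. 2.9] -/
theorem integral_tropical_kirchhoff_eq_graphHeppBoundDim {n V : ℕ} (E : Fin (n + 1) → Fin (V + 1) × Fin (V + 1))
    (hconn : IsConnectedEdgeList E) {D : ℝ} (hD : 0 ≤ D) {ν : Fin (n + 1) → ℝ} (hν : ∀ e, 0 ≤ ν e)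
    (hω : ∀ γ : Finset (Fin (n + 1)), γ.Nonempty → γ ≠ univ → 0 < graphSdc E D ν γ)
    (hlog : graphSdc E D ν univ = 0) :
    ∫ y : Fin n → ℝ, (∏ e, exp (Fin.snoc (α := fun _ => ℝ) y 0 e) ^ ν e) /
        trop (kirchhoffPolynomial ℝ E) (fun k => exp (Fin.snoc (α := fun _ => ℝ) y 0 k)) ^ (D / 2) =
      graphHeppBoundDim E D ν := by
  set zA : Finset (Fin (n + 1)) → ℝ := fun γ => ∑ e ∈ γ, ν e with hzAdef
  set zB : Finset (Fin (n + 1)) → ℝ := (D / 2) • fun γ : Finset (Fin (n + 1)) => (loopNumber E γ : ℝ) with hzBdef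
  have hD2 : 0 ≤ D / 2 := by positivity
  have h0A : zA ∅ = 0 := by simp [hzAdef]
  have h0B : zB ∅ = 0 := by simp [hzBdef, loopNumber_empty]
  have hr_eq : ∀ A : Finset (Fin (n + 1)), zA A - zB A = graphSdc E D ν A := fun A => by
    rw [graphSdc_eq_weights_sub_smul_loopNumber]
  have hA : (∑ e, ν e • NP⟦(X e : MvPolynomial (Fin (n + 1)) ℝ)⟧) = gpPolytope zA :=
    sum_smul_newtonPolytope_X_eq_gpPolytope ν
  have hB : (∑ _j : Fin 1, (D / 2) • NP⟦kirchhoffPolynomial ℝ E⟧) = gpPolytope zB := by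
    rw [Fin.sum_univ_one]
    exact smul_newtonPolytope_kirchhoffPolynomial_eq_gpPolytope E hconn hD2
  have hr : ∀ A : Finset (Fin (n + 1)), A.Nonempty → A ≠ univ → zB A < zA A := fun A hA hA' =>
    sub_pos.1 ((hr_eq A).symm ▸ hω A hA hA')
  have htop : zA univ = zB univ := sub_eq_zero.1 ((hr_eq univ).trans hlog)
  have key := integral_tropical_eq_sectorTable_of_gp (a := fun e => (X e : MvPolynomial (Fin (n + 1)) ℝ))
    (b := fun _ : Fin 1 => kirchhoffPolynomial ℝ E) (ν := ν) (ρ := fun _ : Fin 1 => D / 2)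
    (fun e => X_ne_zero e) (fun _ => kirchhoffPolynomial_ne_zero E ℝ hconn) hν (fun _ => hD2)
    (supermodular_sum_weights ν) (supermodular_smul (supermodular_loopNumber E) hD2) h0A h0B hA hB hr htop
  simp only [trop_X, Fin.prod_univ_one] at key
  rw [key]
  -- `zA A - zB A` is `graphSdc E D ν A` by `rfl` (`hr_eq`), so the two sector tables agree definitionally
  exact sectorTable_graphSdc_eq_graphHeppBoundDim E D ν

end Integral

end Literature.MathematicalPhysics.QuantumFieldTheory
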